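import Summits.ABC.IUTFork.Joshi.AdelicAnsatzPeriodBridge
import HarnessLib

/-!
# [J-III] §4.5 — the existence presupposition of the standard Ansatz point `z_Θ` REDUCED, over T-07's DEFINED Ansatz, to
# §4.4's choice of `y′_0` and one LOCAL Ansatz tuple per bad place ending over the canonical point (block E, T-08)

Proof-only companion (abc-iut cell, block E, rung LADDER-ABC:A2.E; seat abc-iut-E-t8) of `Joshi/AnsatzStandardPoint.lean` (p429131:
the claim-Prop `AnsatzCurveDatum.StandardAnsatzPointExists` = the presupposition of [J-III] arXiv:2401.13508v4 §4.5, p.36 l.11–17,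
"Let `z_Θ = (y_1, …, y_{ℓ⋇}) ∈ Σ̃_{L′}` be chosen such that `y_{ℓ⋇} = y′_0`") and of `Joshi/AdelicAnsatzPeriodBridge.lean` (p431312:
`AdelicCurveDatum.StandardPointData.toAnsatzCurveDatum`, T-08's carrier built from T-07's `AdelicCurveDatum` with `ansatz :=
adelicAnsatz`, i.e. MOCHIZUKI'S ADELIC ANSATZ AS DEFINED by [J-III] Def. 4.2.2 / (4.2.3), p.31 l.48–81: diagonal off `V^{odd,ss}`,
a point of the local Ansatz `Σ̃_{C♭_p,L′_w}` (4.2.1.4) at `w ∈ V^{odd,ss}`).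

WHAT IS PROVED (`standardAnsatzPointExists_of_local`). Over the reconciled carrier the existence of a standard Ansatz point FOLLOWS
from exactly the two choices print makes: (a) a standard point `y′_0` of `𝒴′_{L′}` (§4.4, p.35 l.24–98: a closed classical point over
the canonical point at every `w ∈ V^non`; [J-IIh] §7.1 "choose … `y_v` … in the fibre over the canonical point"), and (b) at each
`w ∈ V^{odd,ss}` a tuple of the LOCAL Ansatz whose last entry lies over the canonical point (the datum of the proof of [J-IIp] Thm. 9.2.1,
arXiv:2303.01662v3 p.27 l.5–24: "`y_0 ∈ Y_{C♭_p,ℚ_p}` a closed classical point lying in the fiber over the canonical point … let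
`t ∈ C♭_p` be such that `([t] − p)` … corresponds to `y_0`", with the tuple `([a^{j²}] − p)_j`, `a = t^{1/ℓ⋇²}`, ending at `[t] − p`; cf.
abc-iut-E-t3's `PrototypeDatum.CanonicalPoint` / `RootTower` in `Joshi/ThetaLocusPrototype.lean`, `Joshi/ThetaLocusSaturation.lean`).
The glued tuple is `y′_0` diagonally off `V^{odd,ss}` and the chosen local tuple at `w ∈ V^{odd,ss}` (`glue`); it lies in `Σ̃_{L′}`
(`glue_mem_adelicAnsatz`) and its last coordinate is standard (`glue_last_standard`). So `StandardAnsatzPointExists` is no longer an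
opaque claim over the reconciled carrier: it is (a) ∧ (b), both of which print supplies by CHOICE plus Fargues–Fontaine facts
(non-empty fibres over the canonical point; roots in the algebraically closed `C♭_p`) that stay hypotheses here. Kernel glue only;
TAKES NO SIDE on [IUTchIII] Cor. 3.12 or on any author; typed ≠ proved. No `Cor312*`/`Thm311*` import (E-PLAN R14). Standard
axioms; sorry-free.
-/

noncomputable section

open Set

namespace Summit.ABC.IUTFork.Joshi

namespace AdelicCurveDatum

variable (D : AdelicCurveDatum)

open Classical in
/-- The GLUED tuple of §4.5: off `V^{odd,ss}` every entry is the given point `y′_0` (Def. 4.2.2's diagonal clause), at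
`w ∈ V^{odd,ss}` the `w`-component is the chosen local tuple `t_w`. [claim: Joshi2024ATS3, status: disputed] -/
def glue (y₀ : D.Curve) (t : ∀ w : D.V, w ∈ D.oddss → (Fin D.lstar → D.Y w)) : D.Tuple :=
  fun i w => if h : w ∈ D.oddss then t w h i else y₀ w

/-- Entries of the glued tuple at a bad place. [folklore] -/
theorem glue_apply_of_mem (y₀ : D.Curve) (t : ∀ w : D.V, w ∈ D.oddss → (Fin D.lstar → D.Y w)) (i : Fin D.lstar)
    {w : D.V} (hw : w ∈ D.oddss) : D.glue y₀ t i w = t w hw i := by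
  unfold glue
  rw [dif_pos hw]

/-- Entries of the glued tuple off the bad places. [folklore] -/
theorem glue_apply_of_not_mem (y₀ : D.Curve) (t : ∀ w : D.V, w ∈ D.oddss → (Fin D.lstar → D.Y w)) (i : Fin D.lstar)
    {w : D.V} (hw : w ∉ D.oddss) : D.glue y₀ t i w = y₀ w := by
  unfold glue
  rw [dif_neg hw]

/-- **The glued tuple lies in MOCHIZUKI'S ADELIC ANSATZ `Σ̃_{L′}` as DEFINED (Def. 4.2.2 / (4.2.3))** when each chosen `w`-component
is a point of the local Ansatz (4.2.1.4). [folklore] -/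
theorem glue_mem_adelicAnsatz (y₀ : D.Curve) (t : ∀ w : D.V, w ∈ D.oddss → (Fin D.lstar → D.Y w))
    (ht : ∀ (w : D.V) (hw : w ∈ D.oddss), t w hw ∈ D.localAnsatz w) : D.glue y₀ t ∈ D.adelicAnsatz := by
  refine ⟨fun w hw i => ?_, fun w hw => ?_⟩
  · rw [D.glue_apply_of_not_mem y₀ t i hw, D.glue_apply_of_not_mem y₀ t D.jOne hw]
  · have : D.comp (D.glue y₀ t) w = t w hw := by
      funext i; exact D.glue_apply_of_mem y₀ t i hw
    rw [this]; exact ht w hw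

namespace StandardPointData

variable {D} (E : D.StandardPointData)

/-- **Its last coordinate is a standard point of `𝒴′_{L′}`** when `y′_0` is standard and each local tuple ends over the canonical
point. [folklore] -/
theorem glue_last_standard {y₀ : D.Curve} (hy₀ : E.toAnsatzCurveDatum.IsStandardPoint y₀)
    (t : ∀ w : D.V, w ∈ D.oddss → (Fin D.lstar → D.Y w))
    (hlast : ∀ (w : D.V) (hw : w ∈ D.oddss), E.quot w (t w hw D.jLast) = E.canon w) :
    E.toAnsatzCurveDatum.IsStandardPoint (D.glue y₀ t D.jLast) := by
  intro w hwnon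
  show E.quot w (D.glue y₀ t D.jLast w) = E.canon w
  by_cases hw : w ∈ D.oddss
  · rw [D.glue_apply_of_mem y₀ t D.jLast hw]; exact hlast w hw
  · rw [D.glue_apply_of_not_mem y₀ t D.jLast hw]; exact hy₀ w hwnon

/-- **[J-III] §4.5, the existence presupposition, REDUCED** over the reconciled carrier: a standard point `y′_0` (§4.4) and, at each
`w ∈ V^{odd,ss}`, a local Ansatz tuple whose last entry lies over the canonical point ([J-IIp] proof of Thm. 9.2.1, p.27 l.5–24) give
a standard Ansatz point; hence `StandardAnsatzPointExists`. [folklore] -/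
theorem standardAnsatzPointExists_of_local {y₀ : D.Curve} (hy₀ : E.toAnsatzCurveDatum.IsStandardPoint y₀)
    (hloc : ∀ (w : D.V), w ∈ D.oddss →
      ∃ t : Fin D.lstar → D.Y w, t ∈ D.localAnsatz w ∧ E.quot w (t D.jLast) = E.canon w) :
    E.toAnsatzCurveDatum.StandardAnsatzPointExists := by
  choose t ht hlast using hloc
  exact ⟨D.glue y₀ t, D.glue_mem_adelicAnsatz y₀ t ht, E.glue_last_standard hy₀ t hlast⟩

/-- The glued tuple IS a standard Ansatz point (the two clauses together), usable as `Dictionary.std` material via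
`IsStandardAnsatzPoint.toAnsatzPt`. [folklore] -/
theorem glue_isStandardAnsatzPoint {y₀ : D.Curve} (hy₀ : E.toAnsatzCurveDatum.IsStandardPoint y₀)
    (t : ∀ w : D.V, w ∈ D.oddss → (Fin D.lstar → D.Y w))
    (ht : ∀ (w : D.V) (hw : w ∈ D.oddss), t w hw ∈ D.localAnsatz w)
    (hlast : ∀ (w : D.V) (hw : w ∈ D.oddss), E.quot w (t w hw D.jLast) = E.canon w) :
    E.toAnsatzCurveDatum.IsStandardAnsatzPoint (D.glue y₀ t) :=
  ⟨D.glue_mem_adelicAnsatz y₀ t ht, E.glue_last_standard hy₀ t hlast⟩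

end StandardPointData

end AdelicCurveDatum

end Summit.ABC.IUTFork.Joshi

end
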